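import Mathlib

/-!
# Eigen-coset lifting (engine 1's `W(f)` toy model, target T101 — an instrument, NOT a resolution theorem)

Pure group theory behind the EIGEN-LIFT LEMMA of the toy model (RE-DERIVATION-eng1-g43 §3.2, STEP 2; CARVER-NOTES-eng1-g43 §2 T101):
in a group `G` with subgroups `N' ≤ N`, `[G, N] ⊆ N'`, `N / N'` of exponent `p`, and an endomorphism `s` of `G` acting on `N / N'` as the
scalar `λ` (`s n ≡ n ^ λ`), every `x` with `s x = x ^ n₀ * h`, `h ∈ N` and `λ ≢ n₀ (mod p)` has a representative `x' = x * g`, `g ∈ N`, with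
`s x' = x' ^ n₀ * h'`, `h' ∈ N'` (`lift`).  Iterating along a descending filtration `F a ⊇ F (a+1) ⊇ ⋯ ⊇ F b` whose non-resonant levels
`a ≤ m < b` all have `λ m ≢ n₀` pushes the error term from `F a` into `F b` (`lift_filtration`).

Toy-model dictionary (order filtration (F1)–(F5) of RE-DERIVATION-eng1-g43 §3.1): `G = H = ⟨s_μ X : μ ∈ 𝔽_p^×⟩`, `F m = H ∩ 𝔄_m`
(automorphisms `≡ id mod σ^m`), `s = s_{μ₀}`, `λ m = μ₀^m`, `n₀ ≡ μ₀^r`; the resonant levels are `m ≡ r (mod p - 1)`.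
No hypothesis `(P)` and no polynomial algebra enters: this file is the group-theoretic skeleton only.
-/

namespace Literature.AlgebraicGeometry.Resolution.WeightedBlowup.EigenCosetLift

variable {G : Type*} [Group G]

/-- `[G, N] ⊆ N' ≤ N` makes `N'` a normal subgroup (bookkeeping). [cite: Lang2002, Ch. I §3] -/
theorem normal_of_commutator_mem {N N' : Subgroup G} (hN'N : N' ≤ N)
    (hcomm : ∀ g : G, ∀ n ∈ N, g * n * g⁻¹ * n⁻¹ ∈ N') : N'.Normal := by
  refine ⟨fun n hn g => ?_⟩
  have h := N'.mul_mem (hcomm g n (hN'N hn)) hn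
  rwa [inv_mul_cancel_right] at h

/-- The correcting exponent: if `p ∤ d` then `p ∣ 1 + e·d` for some integer `e` (`𝔽_p` is a field). [cite: Lang2002, Ch. I §6, Ch. II §2] -/
theorem exists_exponent (p : ℕ) [hp : Fact p.Prime] {d : ℤ} (hd : ¬ (p : ℤ) ∣ d) : ∃ e : ℤ, (p : ℤ) ∣ 1 + e * d := by
  haveI : NeZero p := ⟨hp.out.ne_zero⟩
  have hd' : (d : ZMod p) ≠ 0 := fun h => hd ((ZMod.intCast_zmod_eq_zero_iff_dvd d p).mp h)
  refine ⟨-(((d : ZMod p)⁻¹).val : ℤ), (ZMod.intCast_zmod_eq_zero_iff_dvd _ p).mp ?_⟩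
  push_cast
  rw [ZMod.natCast_zmod_val, neg_mul, inv_mul_cancel₀ hd', add_neg_cancel]

/-- In `G ⧸ N'`, `[G, N] ⊆ N'` means that the image of `N` is central (bookkeeping). [cite: Lang2002, Ch. I §3] -/
theorem commute_mk_of_commutator_mem {N N' : Subgroup G} [N'.Normal]
    (hcomm : ∀ g : G, ∀ n ∈ N, g * n * g⁻¹ * n⁻¹ ∈ N') (g : G) {n : G} (hn : n ∈ N) :
    Commute (n : G ⧸ N') (g : G ⧸ N') := by
  have h1 : ((g * n * g⁻¹ * n⁻¹ : G) : G ⧸ N') = 1 := (QuotientGroup.eq_one_iff _).mpr (hcomm g n hn)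
  rw [QuotientGroup.mk_mul, QuotientGroup.mk_mul, QuotientGroup.mk_mul, QuotientGroup.mk_inv, QuotientGroup.mk_inv,
    mul_inv_eq_one, mul_inv_eq_iff_eq_mul] at h1
  exact h1.symm

/-- In `G ⧸ N'`, "`s` acts on `N / N'` as the scalar `λ`" reads `s n = n ^ λ` (bookkeeping). [cite: Lang2002, Ch. I §3] -/
theorem mk_map_eq_zpow (s : G →* G) {N N' : Subgroup G} [N'.Normal] {la : ℤ}
    (hs : ∀ n ∈ N, s n * (n ^ la)⁻¹ ∈ N') {n : G} (hn : n ∈ N) : (s n : G ⧸ N') = (n : G ⧸ N') ^ la := by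
  have h1 : ((s n * (n ^ la)⁻¹ : G) : G ⧸ N') = 1 := (QuotientGroup.eq_one_iff _).mpr (hs n hn)
  rwa [QuotientGroup.mk_mul, QuotientGroup.mk_inv, mul_inv_eq_one, QuotientGroup.mk_zpow] at h1

/-- **Eigen-coset lift, one level** (RE-DERIVATION-eng1-g43 §3.2 STEP 2, abstract form; instrument for engine 1's `W(f)` toy model, NOT a
resolution theorem).  `N' ≤ N ≤ G`, `[G, N] ⊆ N'`, `N / N'` of exponent `p`, `s` acts on `N / N'` as the scalar `λ = la`, `p ∤ la - n₀`:
if `s x = x ^ n₀ * h` with `h ∈ N`, then `s (x * g) = (x * g) ^ n₀ * h'` for some `g ∈ N`, `h' ∈ N'` (take `g = h ^ e`, `p ∣ 1 + e (la - n₀)`: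
modulo `N'` the error becomes `h ^ (1 + e (la - n₀)) = 1`). [cite: Lang2002, Ch. I §§3, 6; AbramovichTemkinWlodarczyk2024, §5.1 (p. 1575)] -/
theorem lift (s : G →* G) {N N' : Subgroup G} (hN'N : N' ≤ N) (hcomm : ∀ g : G, ∀ n ∈ N, g * n * g⁻¹ * n⁻¹ ∈ N')
    (p : ℕ) [Fact p.Prime] (hexp : ∀ n ∈ N, n ^ p ∈ N') (la n₀ : ℤ) (hs : ∀ n ∈ N, s n * (n ^ la)⁻¹ ∈ N')
    (hla : ¬ (p : ℤ) ∣ la - n₀) {x h : G} (hh : h ∈ N) (hx : s x = x ^ n₀ * h) :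
    ∃ g ∈ N, ∃ h' ∈ N', s (x * g) = (x * g) ^ n₀ * h' := by
  haveI := normal_of_commutator_mem hN'N hcomm
  obtain ⟨e, k, hk⟩ := exists_exponent p hla
  refine ⟨h ^ e, N.zpow_mem hh e, ((x * h ^ e) ^ n₀)⁻¹ * s (x * h ^ e), ?_, (mul_inv_cancel_left _ _).symm⟩
  rw [← QuotientGroup.eq_one_iff, map_mul, hx, map_zpow]
  have hp1 : ((h : G ⧸ N') ^ (p : ℤ)) = 1 := by
    rw [zpow_natCast, ← QuotientGroup.mk_pow]
    exact (QuotientGroup.eq_one_iff _).mpr (hexp h hh)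
  have hsh : (s h : G ⧸ N') = (h : G ⧸ N') ^ la := mk_map_eq_zpow s hs hh
  have hc : Commute (x : G ⧸ N') ((h : G ⧸ N') ^ e) := ((commute_mk_of_commutator_mem hcomm x hh).zpow_left e).symm
  simp only [QuotientGroup.mk_mul, QuotientGroup.mk_inv, QuotientGroup.mk_zpow]
  rw [hsh, hc.mul_zpow, mul_inv_rev, mul_assoc ((x : G ⧸ N') ^ n₀) (h : G ⧸ N') _, mul_assoc (((h : G ⧸ N') ^ e) ^ n₀)⁻¹,
    inv_mul_cancel_left, ← zpow_mul, ← zpow_mul, ← zpow_neg, ← zpow_one_add, ← zpow_add]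
  have hexp' : -(e * n₀) + (1 + la * e) = p * k := by
    rw [← hk]
    ring
  rw [hexp', zpow_mul, hp1, one_zpow]

/-- **Eigen-coset lift along a filtration** (RE-DERIVATION-eng1-g43 §3.2 STEP 2 iterated; instrument, NOT a resolution theorem).
`F` a descending chain of subgroups with `[G, F m] ⊆ F (m+1)`, `F m / F (m+1)` of exponent `p` on which `s` acts as the scalar `la m`; if
every level `a ≤ m < b` is non-resonant (`p ∤ la m - n₀`) then `s x = x ^ n₀ * h`, `h ∈ F a`, can be improved to `s (x * g) = (x * g) ^ n₀ * h'`
with `g ∈ F a`, `h' ∈ F b`. [cite: Lang2002, Ch. I §§3, 6; AbramovichTemkinWlodarczyk2024, §5.1 (p. 1575)] -/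
theorem lift_filtration (s : G →* G) (p : ℕ) [Fact p.Prime] (n₀ : ℤ) (F : ℕ → Subgroup G) (hF : Antitone F)
    (hcomm : ∀ m, ∀ g : G, ∀ n ∈ F m, g * n * g⁻¹ * n⁻¹ ∈ F (m + 1)) (hexp : ∀ m, ∀ n ∈ F m, n ^ p ∈ F (m + 1))
    (la : ℕ → ℤ) (hs : ∀ m, ∀ n ∈ F m, s n * (n ^ la m)⁻¹ ∈ F (m + 1)) {a b : ℕ} (hab : a ≤ b)
    (hla : ∀ m, a ≤ m → m < b → ¬ (p : ℤ) ∣ la m - n₀) {x h : G} (hh : h ∈ F a) (hx : s x = x ^ n₀ * h) :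
    ∃ g ∈ F a, ∃ h' ∈ F b, s (x * g) = (x * g) ^ n₀ * h' := by
  refine Nat.le_induction (m := a)
    (P := fun b _ => (∀ m, a ≤ m → m < b → ¬ (p : ℤ) ∣ la m - n₀) → ∃ g ∈ F a, ∃ h' ∈ F b, s (x * g) = (x * g) ^ n₀ * h')
    ?_ ?_ b hab hla
  · intro _
    exact ⟨1, one_mem _, h, hh, by rw [mul_one]; exact hx⟩
  · intro b hab ih hlab
    obtain ⟨g₁, hg₁, h₁, hh₁, h1⟩ := ih fun m hm1 hm2 => hlab m hm1 (hm2.trans b.lt_succ_self)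
    obtain ⟨g₂, hg₂, h₂, hh₂, h2⟩ := lift s (hF b.le_succ) (hcomm b) p (hexp b) (la b) n₀ (hs b)
      (hlab b hab b.lt_succ_self) hh₁ h1
    exact ⟨g₁ * g₂, mul_mem hg₁ (hF hab hg₂), h₂, hh₂, by rw [← mul_assoc]; exact h2⟩

/-- The terminal case of the toy model (`F b = ⊥`, e.g. `𝔄_{p+2} = {id}` for `r ≥ 3`): the lifted representative is an exact
eigen-element, `s x' = x' ^ n₀`. [cite: Lang2002, Ch. I §§3, 6; AbramovichTemkinWlodarczyk2024, §5.1 (p. 1575)] -/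
theorem lift_filtration_exact (s : G →* G) (p : ℕ) [Fact p.Prime] (n₀ : ℤ) (F : ℕ → Subgroup G) (hF : Antitone F)
    (hcomm : ∀ m, ∀ g : G, ∀ n ∈ F m, g * n * g⁻¹ * n⁻¹ ∈ F (m + 1)) (hexp : ∀ m, ∀ n ∈ F m, n ^ p ∈ F (m + 1))
    (la : ℕ → ℤ) (hs : ∀ m, ∀ n ∈ F m, s n * (n ^ la m)⁻¹ ∈ F (m + 1)) {a b : ℕ} (hab : a ≤ b) (hb : F b = ⊥)
    (hla : ∀ m, a ≤ m → m < b → ¬ (p : ℤ) ∣ la m - n₀) {x h : G} (hh : h ∈ F a) (hx : s x = x ^ n₀ * h) :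
    ∃ g ∈ F a, s (x * g) = (x * g) ^ n₀ := by
  obtain ⟨g, hg, h', hh', h1⟩ := lift_filtration s p n₀ F hF hcomm hexp la hs hab hla hh hx
  rw [hb, Subgroup.mem_bot] at hh'
  exact ⟨g, hg, by rw [h1, hh', mul_one]⟩

end Literature.AlgebraicGeometry.Resolution.WeightedBlowup.EigenCosetLift
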